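import Mathlib.NumberTheory.NumberField.CMField
import HarnessLib

/-!
# Hasse's unit index is invariant in CM extensions of odd degree (Hirabayashi–Yoshino; Lemmermeyer 1995)

Topic `NumberTheory/NumberFields`; namespace `Literature.NumberTheory.NumberFields`. A NAMED FACT
(D-0014: `def … : Prop`, nothing asserted, no `sorry`) vendored while grounding route
`QuantumAdvantage/ThirdFactorialPincer`, support item `NormIsRelClassNumber`
(stmt-QuantumAdvantage-11649): "`|S_p|² · h(K_p) = h(F_p)` for `K_p` the cubic field of discriminant
`p²` and `F_p = K_p(ω)` the abelian sextic field of discriminant `−27p⁴`" — i.e. the relative class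
number formula `h⁻ = Q w ∏_{χ odd} (−½ B_{1,χ})` ([Lang1990, Ch. 3 §3, Thm. 3.2 and CNF⁻]) with
unit index `Q(F_p) = 1`. The route card checks `Q = 1` numerically (`bnfinit`, 45 primes); in
print it is the theorem below applied to `ℚ(ω) ⊂ F_p`, `(F_p : ℚ(ω)) = 3` odd, together with
`Q(ℚ(ω)) = 1` (an imaginary quadratic field has no units beyond its roots of unity).

## Source (held text `paper:arxiv-1202.5777` = the Acta Arith. paper, read 2026-08-15)

F. Lemmermeyer, *Ideal class groups of cyclotomic number fields I*, Acta Arith. **72** (1995)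
347–359 [Lemmermeyer1995], §1 (notation): for a CM-field `K` — "a totally complex quadratic
extension of a totally real number field" — `K⁺` is its maximal real subfield, `E_K` the unit group,
`W_K` the roots of unity, and "`Q(K) = (E_K : W_K E_{K⁺}) ∈ {1, 2}` is Hasse's unit index";
§2, **Proposition 1**: "Let `K ⊂ L` be CM-fields; then … f) ([HY]) If `(L : K)` is odd, then
`Q(L) = Q(K)`" ([HY] = M. Hirabayashi, K. Yoshino, *Remarks on unit indices of imaginary abelian
number fields*, Manuscripta Math. 60 (1988) 423–436; Lemmermeyer proves f) from d) (Hasse, Satz 29: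
`Q(K) ∣ Q(L)·(W_L : W_K)`) and e)).

## Tree form

Mathlib has CM fields: `NumberField.IsCMField K` (totally complex, quadratic over
`NumberField.maximalRealSubfield K`), and Hasse's index verbatim as
`NumberField.IsCMField.indexRealUnits K = (realUnits K ⊔ torsion K).index`, the index in `(𝓞 K)ˣ`
of the subgroup generated by the units of `K⁺` and the roots of unity, with
`indexRealUnits_eq_one_or_two` (= Prop. 1 a)). "`K ⊂ L`" is an `Algebra K L` between the two
fields (any ring map of fields is an embedding); `(L : K) = Module.finrank K L`. Nothing weaker or
stronger than print. Not in Mathlib (searched `indexRealUnits`: only the definition, `_mul_eq`,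
`_eq_one_or_two`, `_eq_two_iff`, and the regulator ratio).

## References

* [Lemmermeyer1995] F. Lemmermeyer, Acta Arith. 72 (1995), §2 Proposition 1 f) (and a), d), e)).
* M. Hirabayashi, K. Yoshino, Manuscripta Math. 60 (1988) 423–436 — the original source of f).
* H. Hasse, *Über die Klassenzahl abelscher Zahlkörper* (1952; Springer 1985), Sätze 14–29.
* [Lang1990] S. Lang, *Cyclotomic Fields I and II*, GTM 121, Ch. 3 §3 (unit index `Q`, Thm. 3.2,
  CNF⁻) and §4 Thm. 4.1 (`Q = 1` for prime-power cyclotomic fields) — context.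
-/

namespace Literature.NumberTheory.NumberFields

/-- **Lemmermeyer 1995, Proposition 1 f) (after Hirabayashi–Yoshino 1988): in an extension
`K ⊂ L` of CM-fields of odd degree, Hasse's unit indices agree, `Q(L) = Q(K)`.** Here
`Q(K) = (E_K : W_K E_{K⁺})` is Mathlib's `NumberField.IsCMField.indexRealUnits K`. Used with
`K = ℚ(ω) ⊂ L = F_p` (degree `3`) to get `Q(F_p) = Q(ℚ(ω)) = 1` in the relative class number
formula behind `Summit.QuantumAdvantage.QuantumAdvantage.Theses.ThirdFactorialPincer.NormIsRelClassNumber`.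
[cite: Lemmermeyer1995, §2 Proposition 1 f)] -/
def Lemmermeyer1995_unitIndex_eq_of_odd_degree : Prop :=
  ∀ (K L : Type) [Field K] [NumberField K] [NumberField.IsCMField K]
    [Field L] [NumberField L] [NumberField.IsCMField L] [Algebra K L],
    Odd (Module.finrank K L) →
      NumberField.IsCMField.indexRealUnits L = NumberField.IsCMField.indexRealUnits K

/-- Unfolding lemma. [cite: Lemmermeyer1995, §2 Proposition 1 f)] -/
theorem Lemmermeyer1995_unitIndex_eq_of_odd_degree_iff :
    Lemmermeyer1995_unitIndex_eq_of_odd_degree ↔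
      ∀ (K L : Type) [Field K] [NumberField K] [NumberField.IsCMField K]
        [Field L] [NumberField L] [NumberField.IsCMField L] [Algebra K L],
        Odd (Module.finrank K L) →
          NumberField.IsCMField.indexRealUnits L = NumberField.IsCMField.indexRealUnits K :=
  Iff.rfl

/-! ## Proof of Proposition 1 f) — discharge of the named fact above

We follow Lemmermeyer's proof [Lemmermeyer1995, §2, proof of Proposition 1, items a), d), e),
f), p. 350] in Mathlib's normal form. For a CM-field `F` write `W_F = torsion F` (a finite
cyclic group of even order), `σ = complexConj F`, and
`φ_F = unitsMulComplexConjInv F : E_F → W_F`, `u ↦ u ^ (1 - σ) = u / ū`.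

* a) Mathlib's `indexRealUnits_mul_eq` is `Q(F) · (W_F : φ_F(E_F)) = 2`; since
  `W_F² = φ_F(W_F) ⊆ φ_F(E_F)` has index `2`, this gives `Q(F) = 1 ↔ φ_F(E_F) ⊆ W_F²`
  (`indexRealUnits_eq_one_iff`; in print: `Q(F) = (E_F^{σ-1} : W_F²)`).
* For `K ⊂ L` let `ι : W_K → W_L` be the inclusion and `N = N_{L/K} : W_L → W_K` the norm; then
  `N ∘ ι = (·) ^ n` with `n = (L : K)`, `ι ∘ φ_K = φ_L ∘ ι` (complex conjugation of `L`
  restricts to that of `K`, `complexConj_algebraMap`) and `N ∘ φ_L = φ_K ∘ N` (the norm commutes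
  with complex conjugation, `norm_complexConj`).
* d) `Q(K) = 2 ⟹ Q(L) = 2` (in print from `Q(K) ∣ Q(L) · (W_L : W_K)` and `(W_L : W_K)` odd):
  if `x ∈ φ_K(E_K)` becomes a square `ι x = r²` in `W_L`, then `x ^ n = N(r)²`, and `n` odd makes
  `x` a square in `W_K`.
* e) `Q(L) = 2 ⟹ Q(K) = 2` ("taking the norm to `K`"): the hypothesis of e), that
  `N : W_L/W_L² → W_K/W_K²` is onto, holds for odd `n` because `N(ι ξ) = ξ ^ n` is a non-square
  for `ξ` a generator of `W_K`; hence `N` maps a generator of `W_L` to a non-square of `W_K`, and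
  `N(y) ∈ W_K²` forces `y ∈ W_L²`.

d) and e) together are the purely group-theoretic lemma
`Lemmermeyer1995.forall_mem_isSquare_iff_of_odd`; f) combines them with a) and `Q ∈ {1, 2}`
(`indexRealUnits_eq_one_or_two`).
-/

namespace Lemmermeyer1995

open NumberField NumberField.IsCMField NumberField.Units

/-! ### Two lemmas on finite cyclic groups (applied to `W_K`, `W_L`) -/

/-- In a finite commutative group of even order generated by `ξ`, the power `ξ ^ k` is a square
iff `k` is even — i.e. `W/W²` is cyclic of order two, as used in the proof of Lemmermeyer's
Prop. 1 b), e). [folklore] -/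
theorem isSquare_pow_iff_even {A : Type*} [CommGroup A] [Finite A] {ξ : A}
    (hξ : ∀ x, x ∈ Submonoid.powers ξ) (hA : Even (Nat.card A)) (k : ℕ) :
    IsSquare (ξ ^ k) ↔ Even k := by
  refine ⟨fun ⟨r, hr⟩ ↦ ?_, fun ⟨j, hj⟩ ↦ ⟨ξ ^ j, by rw [hj, pow_add]⟩⟩
  obtain ⟨j, rfl⟩ := (Submonoid.mem_powers_iff _ _).mp (hξ r)
  rw [← pow_add, pow_eq_pow_iff_modEq, orderOf_eq_card_of_forall_mem_powers hξ] at hr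
  have h2 := hr.of_dvd (even_iff_two_dvd.mp hA)
  rw [Nat.even_iff]
  unfold Nat.ModEq at h2
  omega

/-- The group-theoretic core of Lemmermeyer's Prop. 1 d), e), f): let `A` (`= W_K`) and
`B` (`= W_L`) be finite cyclic groups, `A` of even order, `ι : A → B` and `N : B → A`
homomorphisms with `N ∘ ι = (·) ^ n` for an odd `n`, and `RA ≤ A`, `RB ≤ B` subgroups
(`= E_K^{σ-1}`, `E_L^{σ-1}`) with `ι(RA) ⊆ RB` and `N(RB) ⊆ RA`. Then `RA` consists of squares
iff `RB` does. [cite: Lemmermeyer1995, §2 Proposition 1 d), e), f) (proof, p. 350)] -/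
theorem forall_mem_isSquare_iff_of_odd {A B : Type*} [CommGroup A] [CommGroup B] [Finite A]
    [Finite B] [IsCyclic A] [IsCyclic B] (hA : Even (Nat.card A)) (ι : A →* B) (N : B →* A)
    {n : ℕ}
    (hn : Odd n) (hNι : ∀ a, N (ι a) = a ^ n) (RA : Subgroup A) (RB : Subgroup B)
    (hι : ∀ a ∈ RA, ι a ∈ RB) (hN : ∀ b ∈ RB, N b ∈ RA) :
    (∀ a ∈ RA, IsSquare a) ↔ (∀ b ∈ RB, IsSquare b) := by
  obtain ⟨ξ, hξ⟩ := IsCyclic.exists_monoid_generator (α := A)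
  obtain ⟨g, hg⟩ := IsCyclic.exists_monoid_generator (α := B)
  have hsq := isSquare_pow_iff_even hξ hA
  refine ⟨fun h b hb ↦ ?_, fun h a ha ↦ ?_⟩
  · -- e): `N` maps the generator `g` of `B` to a non-square of `A` (because `N (ι ξ) = ξ ^ n`
    -- with `n` odd is a non-square), hence `N b` square forces `b` square.
    obtain ⟨m, hm⟩ := (Submonoid.mem_powers_iff _ _).mp (hg (ι ξ))
    obtain ⟨c, hc⟩ := (Submonoid.mem_powers_iff _ _).mp (hξ (N g))
    have hc' : Odd c := by
      rw [← Nat.not_even_iff_odd]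
      intro hce
      have : IsSquare (ξ ^ n) := by
        rw [← hNι, ← hm, map_pow, ← hc, ← pow_mul]
        exact (hsq _).mpr (hce.mul_right m)
      exact (Nat.not_even_iff_odd.mpr hn) ((hsq n).mp this)
    obtain ⟨a, rfl⟩ := (Submonoid.mem_powers_iff _ _).mp (hg b)
    have hNb := h _ (hN _ hb)
    rw [map_pow, ← hc, ← pow_mul, hsq, Nat.even_mul] at hNb
    obtain ⟨j, hj⟩ := hNb.resolve_left (Nat.not_even_iff_odd.mpr hc')
    exact ⟨g ^ j, by rw [hj, pow_add]⟩
  · -- d): `a ^ n = N (ι a)` is a square and `n` is odd, so `a` is a square.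
    obtain ⟨r, hr⟩ := h _ (hι a ha)
    have han : IsSquare (a ^ n) := ⟨N r, by rw [← hNι, hr, map_mul]⟩
    obtain ⟨k, rfl⟩ := hn
    have : a = a ^ (2 * k + 1) * ((a ^ k) ^ 2)⁻¹ := by group
    rw [this]
    exact han.mul (IsSquare.sq _).inv

/-! ### Prop. 1 a) in Mathlib's terms: `Q(K) = 1` iff every `u / ū` is a square in `W_K` -/

/-- Lemmermeyer's Prop. 1 a) (Hasse, Satz 14), `Q(K) = (E_K^{σ-1} : W_K²)`, in the form:
`Q(K) = 1` iff `u ^ (1 - σ) = u / ū` is the square of a root of unity for every unit `u` of `K`.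
Derived from Mathlib's `indexRealUnits_mul_eq`. [cite: Lemmermeyer1995, §2 Proposition 1 a)] -/
theorem indexRealUnits_eq_one_iff (K : Type*) [Field K] [NumberField K] [IsCMField K] :
    indexRealUnits K = 1 ↔ ∀ u : (𝓞 K)ˣ, IsSquare (unitsMulComplexConjInv K u) := by
  have hmul := indexRealUnits_mul_eq K
  have h2 : (powMonoidHom 2 : torsion K →* torsion K).range.index = 2 := by
    rw [IsCyclic.index_powMonoidHom_range, Nat.gcd_eq_right]
    exact even_iff_two_dvd.mp (even_torsionOrder K)
  have hle : (powMonoidHom 2 : torsion K →* torsion K).range ≤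
      (unitsMulComplexConjInv K).range := by
    rw [← map_unitsMulComplexConjInv_torsion]
    exact Subgroup.map_le_range _ _
  constructor
  · intro h u
    rw [h, one_mul] at hmul
    have hrel := Subgroup.relIndex_mul_index hle
    rw [hmul, h2] at hrel
    have hrel' : (powMonoidHom 2 : torsion K →* torsion K).range.relIndex
        (unitsMulComplexConjInv K).range = 1 := by omega
    obtain ⟨r, hr⟩ := Subgroup.relIndex_eq_one.mp hrel' (MonoidHom.mem_range.mpr ⟨u, rfl⟩)
    exact ⟨r, by rw [← hr, powMonoidHom_apply, pow_two]⟩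
  · intro h
    have hle' : (unitsMulComplexConjInv K).range ≤
        (powMonoidHom 2 : torsion K →* torsion K).range := by
      rintro _ ⟨u, rfl⟩
      obtain ⟨r, hr⟩ := h u
      exact ⟨r, by rw [powMonoidHom_apply, pow_two, hr]⟩
    have hdvd := Subgroup.index_dvd_of_le hle'
    rw [h2] at hdvd
    rcases indexRealUnits_eq_one_or_two K with h1 | h1
    · exact h1
    · rw [h1] at hmul
      have h3 : (unitsMulComplexConjInv K).range.index = 1 := by omega
      rw [h3] at hdvd
      exact absurd hdvd (by norm_num)

/-! ### Complex conjugation is compatible with `K ⊂ L` and with the norm `N_{L/K}` -/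

section CM

variable (K L : Type*) [Field K] [NumberField K] [IsCMField K]
    [Field L] [NumberField L] [IsCMField L] [Algebra K L]

/-- For CM-fields `K ⊂ L`, the complex conjugation of `L` restricts to the complex conjugation
of `K` (both are induced by complex conjugation on `ℂ` under any complex embedding).
[cite: Lemmermeyer1995, §1 (notation) and §2 Proposition 1] -/
theorem complexConj_algebraMap (x : K) :
    complexConj L (algebraMap K L x) = algebraMap K L (complexConj K x) := by
  let φ : L →+* ℂ := Classical.choice inferInstance
  apply φ.injective
  have h1 := complexEmbedding_complexConj K (φ.comp (algebraMap K L)) x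
  simp only [RingHom.comp_apply] at h1
  rw [complexEmbedding_complexConj, h1]

/-- For CM-fields `K ⊂ L`, the norm `N_{L/K}` commutes with complex conjugation (the step
"taking the norm to `K`" in the proof of Prop. 1 e)).
[cite: Lemmermeyer1995, §2 Proposition 1 e) (proof)] -/
theorem norm_complexConj (x : L) :
    Algebra.norm K (complexConj L x) = complexConj K (Algebra.norm K x) := by
  have := Algebra.norm_eq_of_equiv_equiv (complexConj K : K ≃+* K) (complexConj L : L ≃+* L)
    (by ext y; simp [complexConj_algebraMap K L]) x
  rw [this]
  simp

omit [NumberField K] [IsCMField K] [NumberField L] [IsCMField L] in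
/-- The inclusion `𝓞 K → 𝓞 L` is the restriction of `K → L`. [folklore] -/
theorem coe_algebraMap_ringOfIntegers (y : 𝓞 K) :
    ((algebraMap (𝓞 K) (𝓞 L) y : 𝓞 L) : L) = algebraMap K L (y : K) := rfl

/-- On units, the inclusion `E_K → E_L` commutes with complex conjugation.
[cite: Lemmermeyer1995, §2 Proposition 1 d) (proof)] -/
theorem unitsMap_unitsComplexConj (u : (𝓞 K)ˣ) :
    Units.map (algebraMap (𝓞 K) (𝓞 L) : 𝓞 K →* 𝓞 L) (unitsComplexConj K u) =
      unitsComplexConj L (Units.map (algebraMap (𝓞 K) (𝓞 L) : 𝓞 K →* 𝓞 L) u) := by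
  ext
  simp [coe_algebraMap_ringOfIntegers, complexConj_algebraMap K L]

/-- On units, the norm `E_L → E_K` commutes with complex conjugation.
[cite: Lemmermeyer1995, §2 Proposition 1 e) (proof)] -/
theorem unitsNorm_unitsComplexConj (v : (𝓞 L)ˣ) :
    Units.map (RingOfIntegers.norm K) (unitsComplexConj L v) =
      unitsComplexConj K (Units.map (RingOfIntegers.norm K) v) := by
  ext
  simp [norm_complexConj K L]

/-- `ι ∘ (1 - σ) = (1 - σ) ∘ ι` on units: `E_K^{σ-1} ⊆ E_L^{σ-1}` (proof of Prop. 1 d)).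
[cite: Lemmermeyer1995, §2 Proposition 1 d) (proof)] -/
theorem unitsMap_unitsMulComplexConjInv (u : (𝓞 K)ˣ) :
    Units.map (algebraMap (𝓞 K) (𝓞 L) : 𝓞 K →* 𝓞 L) (unitsMulComplexConjInv K u : (𝓞 K)ˣ) =
      (unitsMulComplexConjInv L (Units.map (algebraMap (𝓞 K) (𝓞 L) : 𝓞 K →* 𝓞 L) u) :
        (𝓞 L)ˣ) := by
  rw [unitsMulComplexConjInv_apply, unitsMulComplexConjInv_apply, map_mul, map_inv,
    unitsMap_unitsComplexConj]

/-- `N ∘ (1 - σ) = (1 - σ) ∘ N` on units: `(N_{L/K} ε)^{σ-1} = N_{L/K}(ε^{σ-1})`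
(proof of Prop. 1 e)). [cite: Lemmermeyer1995, §2 Proposition 1 e) (proof)] -/
theorem unitsNorm_unitsMulComplexConjInv (v : (𝓞 L)ˣ) :
    Units.map (RingOfIntegers.norm K) (unitsMulComplexConjInv L v : (𝓞 L)ˣ) =
      (unitsMulComplexConjInv K (Units.map (RingOfIntegers.norm K) v) : (𝓞 K)ˣ) := by
  rw [unitsMulComplexConjInv_apply, unitsMulComplexConjInv_apply, map_mul, map_inv,
    unitsNorm_unitsComplexConj]

omit [NumberField K] [IsCMField K] [NumberField L] [IsCMField L] in
/-- `N_{L/K} (u) = u ^ (L : K)` for a unit `u` of `K`. [folklore] -/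
theorem unitsNorm_unitsMap (u : (𝓞 K)ˣ) :
    Units.map (RingOfIntegers.norm K) (Units.map (algebraMap (𝓞 K) (𝓞 L) : 𝓞 K →* 𝓞 L) u) =
      u ^ Module.finrank K L := by
  ext
  simp [RingOfIntegers.norm_algebraMap]

/-- **Lemmermeyer 1995, Prop. 1 f)** in Mathlib's normal form: for CM-fields `K ⊂ L` with
`(L : K)` odd, every `u / ū` (`u ∈ E_K`) is a square in `W_K` iff every `v / v̄` (`v ∈ E_L`) is
a square in `W_L`. [cite: Lemmermeyer1995, §2 Proposition 1 f)] -/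
theorem forall_isSquare_iff (hodd : Odd (Module.finrank K L)) :
    (∀ u : (𝓞 K)ˣ, IsSquare (unitsMulComplexConjInv K u)) ↔
      (∀ v : (𝓞 L)ˣ, IsSquare (unitsMulComplexConjInv L v)) := by
  -- the inclusion `ι : W_K → W_L` and the norm `N : W_L → W_K`
  let ι : torsion K →* torsion L :=
    ((Units.map (algebraMap (𝓞 K) (𝓞 L) : 𝓞 K →* 𝓞 L)).restrict (torsion K)).codRestrict
      (torsion L) fun ζ ↦ by
        have h : IsOfFinOrder (ζ : (𝓞 K)ˣ) := ζ.2
        exact (Units.map (algebraMap (𝓞 K) (𝓞 L) : 𝓞 K →* 𝓞 L)).isOfFinOrder h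
  let N : torsion L →* torsion K :=
    ((Units.map (RingOfIntegers.norm K)).restrict (torsion L)).codRestrict (torsion K)
      fun ζ ↦ by
        have h : IsOfFinOrder (ζ : (𝓞 L)ˣ) := ζ.2
        exact (Units.map (RingOfIntegers.norm K)).isOfFinOrder h
  have := forall_mem_isSquare_iff_of_odd (even_torsionOrder K) ι N hodd
    (fun a ↦ Subtype.ext (unitsNorm_unitsMap K L a))
    (unitsMulComplexConjInv K).range (unitsMulComplexConjInv L).range
    (by
      rintro _ ⟨u, rfl⟩
      exact ⟨_, Subtype.ext (unitsMap_unitsMulComplexConjInv K L u).symm⟩)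
    (by
      rintro _ ⟨v, rfl⟩
      exact ⟨_, Subtype.ext (unitsNorm_unitsMulComplexConjInv K L v).symm⟩)
  simpa using this

end CM

end Lemmermeyer1995

open NumberField.IsCMField in
/-- **Discharge of `Lemmermeyer1995_unitIndex_eq_of_odd_degree`** (Lemmermeyer 1995, Prop. 1 f),
after Hirabayashi–Yoshino): for CM-fields `K ⊂ L` of odd relative degree, `Q(L) = Q(K)`.
Proof as in print: d) and e) (`Lemmermeyer1995.forall_isSquare_iff`) give `Q(K) = 1 ↔ Q(L) = 1`
via a) (`Lemmermeyer1995.indexRealUnits_eq_one_iff`), and `Q ∈ {1, 2}`.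
[cite: Lemmermeyer1995, §2 Proposition 1 f)] -/
theorem Lemmermeyer1995_unitIndex_eq_of_odd_degree_holds :
    Lemmermeyer1995_unitIndex_eq_of_odd_degree := by
  intro K L _ _ _ _ _ _ _ hodd
  have h := Lemmermeyer1995.forall_isSquare_iff K L hodd
  rw [← Lemmermeyer1995.indexRealUnits_eq_one_iff,
    ← Lemmermeyer1995.indexRealUnits_eq_one_iff] at h
  rcases indexRealUnits_eq_one_or_two K with hK | hK <;>
    rcases indexRealUnits_eq_one_or_two L with hL | hL
  · rw [hK, hL]
  · exact absurd (h.mp hK) (by rw [hL]; norm_num)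
  · exact absurd (h.mpr hL) (by rw [hK]; norm_num)
  · rw [hK, hL]

end Literature.NumberTheory.NumberFields
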